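import Mathlib.Analysis.SpecialFunctions.Sqrt
import Literature.Geometry.Lorentzian.KerrSchildMultiplierCurrent
import HarnessLib

/-!
# Radial multipliers `X = g(|y|²) y·∂_y` on Minkowski space: the bulk `K^X`, the wave operator of
# radial weights, and Morawetz's `X = ∂_r` identity

(family `gr`; infrastructure for the large-`r` multiplier estimates behind statement **gr.S24** —
Dafermos–Rodnianski–Shlapentokh-Rothman, arXiv:1402.7034, Prop. 4.6.1 ("An estimate for large
`r`"; "The homogeneous case is treated in [dr7]") — in the coefficient-field framework of
`KerrSchild.waveOperator`, here with the constant Minkowski coefficients `η = diag(−1, 1, 1, 1)`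
(`Kerr.etaComp`), the model to which the Kerr–Schild coefficients `η − 2H ℓ♯ ⊗ ℓ♯` reduce as
`r → ∞`; namespace `Literature.Geometry.Lorentzian.KerrSchild`)

For a radial vector field written smoothly through `s = |y|² = y₁² + y₂² + y₃²`,
`X⁰ = 0`, `X^i = g(s) y_i` (i.e. `X = f(r) ∂_r` with `f = r g(r²)`), and the Minkowski
coefficients, the bulk term of `KerrSchildMultiplierCurrent.lean` is
`K^X = ∑_{ij} p_i p_j ∂_i X^j − ½ (div X) Q`, `Q = −p₀² + |p⃗|²`, with `∂_i X^j = 2g'(s) y_i y_j +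
g(s) δ_{ij}` and `div X = 2 s g'(s) + 3 g(s)`. This file proves:

* `KerrSchild.fderiv_spatialNormSq_apply`, `KerrSchild.fderiv_radialMultiplier_apply` — the
  coordinate derivatives of `s` and of `X`;
* `KerrSchild.multiplierBulk_eta_radial` — **the bulk of a radial multiplier on Minkowski space**:
  `K^X = 2 g'(s) (y⃗·p⃗)² + g(s) |p⃗|² − ½ (2 s g'(s) + 3 g(s)) (−p₀² + |p⃗|²)`;
* `KerrSchild.waveOperator_eta_radial` — **the wave operator of a stationary radial weight**:
  `□_η [φ(s)] = 4 s φ''(s) + 6 φ'(s)` (`= Δ φ(|y|²)` in three space dimensions);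
* `KerrSchild.multiplierBulk_eta_dr_add` — **Morawetz's identity for `X = ∂_r`** (`g = s^{-1/2}`,
  `r = |y⃗| > 0`): with the Lagrangian weight `ϖ = 4/r`,
  `K^X + ¼ ϖ Q = (|p⃗|² r² − (y⃗·p⃗)²)/r³ = |∇̸w|²/r ≥ 0` (`multiplierBulk_eta_dr_add_nonneg`), and
  `□_η (4/r) = 0` away from the axis `r = 0` (`waveOperator_eta_four_div_r`), so that by
  `KerrSchild.sum_fderiv_modifiedCurrent` the modified current `J^{∂_r} + ¼ L_{4/r}` has
  divergence `|∇̸w|²/r + (∂_r w + w/r) □_η w` on `{r > 0}` — non-negative bulk for solutions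
  (Morawetz 1968; Dafermos–Rodnianski arXiv:0811.0354, §4.1).

These are the `a = M = 0` identities behind the current `J^{X,w}` with `X = f(r)∂_r` of the
large-`r` estimate (DRSR Prop. 4.6.1, from [dr7] = Dafermos–Rodnianski arXiv:1010.5132, §5); the
Kerr case adds error terms with coefficients `∂(2H ℓ♯ ⊗ ℓ♯) = O(M r⁻²)`.

## References

* C. S. Morawetz, *Time decay for the nonlinear Klein–Gordon equation*, Proc. Roy. Soc. A 306
  (1968) 291–296 (the radial multiplier `∂_r`).
* M. Dafermos, I. Rodnianski, *Lectures on black holes and linear waves*, arXiv:0811.0354, §4.1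
  (Morawetz's estimate on Minkowski space via `J^{X,w}`) (key `DafermosRodnianski2008`).
* M. Dafermos, I. Rodnianski, Y. Shlapentokh-Rothman, arXiv:1402.7034 = Ann. of Math. 183 (2016),
  Prop. 4.6.1 (key `DafermosRodnianskiShlapentokhrothman2014`).
-/

noncomputable section

open Set Filter
open scoped ContDiff Topology

namespace Literature.Geometry.Lorentzian

namespace KerrSchild

/-! ### Coordinate calculus on `E4` -/

/-- The coordinate function `y ↦ y^μ` has derivative `dx^μ`. [folklore] -/
theorem hasFDerivAt_coord (μ : Fin 4) (x : E4) : HasFDerivAt (fun y : E4 ↦ y μ) (E4.dx μ) x :=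
  (E4.dx μ).hasFDerivAt

/-- `∂_ν y^μ = δ^μ_ν`. [folklore] -/
theorem fderiv_coord_apply (μ ν : Fin 4) (x : E4) :
    fderiv ℝ (fun y : E4 ↦ y μ) x (E4.basisVector ν) = if μ = ν then 1 else 0 := by
  rw [(hasFDerivAt_coord μ x).fderiv, Kerr.dx_basisVector]

/-- **The squared spatial radius `s = y₁² + y₂² + y₃²` is differentiable** with derivative
`2 (y₁ dx¹ + y₂ dx² + y₃ dx³)`. [folklore] -/
theorem hasFDerivAt_spatialNormSq (x : E4) :
    HasFDerivAt (fun y : E4 ↦ E4.spatialNorm y ^ 2)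
      ((2 * x 1) • E4.dx 1 + (2 * x 2) • E4.dx 2 + (2 * x 3) • E4.dx 3) x := by
  have h : (fun y : E4 ↦ E4.spatialNorm y ^ 2) = fun y ↦ y 1 ^ 2 + y 2 ^ 2 + y 3 ^ 2 :=
    funext E4.spatialNorm_sq
  rw [h]
  have h1 := (hasFDerivAt_coord 1 x).pow 2
  have h2 := (hasFDerivAt_coord 2 x).pow 2
  have h3 := (hasFDerivAt_coord 3 x).pow 2
  refine ((h1.add h2).add h3).congr_fderiv ?_
  ext v
  simp only [add_apply, smul_apply, smul_eq_mul, pow_one, Nat.add_one_sub_one]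
  ring

/-- **`∂_μ s`**: `∂_0 s = 0`, `∂_i s = 2 y_i`. [folklore] -/
theorem fderiv_spatialNormSq_apply (x : E4) (μ : Fin 4) :
    fderiv ℝ (fun y : E4 ↦ E4.spatialNorm y ^ 2) x (E4.basisVector μ) =
      if μ = 0 then 0 else 2 * x μ := by
  rw [(hasFDerivAt_spatialNormSq x).fderiv]
  simp only [add_apply, smul_apply, smul_eq_mul, Kerr.dx_basisVector]
  fin_cases μ <;> simp

/-- The squared spatial radius is differentiable. [folklore] -/
theorem differentiableAt_spatialNormSq (x : E4) :
    DifferentiableAt ℝ (fun y : E4 ↦ E4.spatialNorm y ^ 2) x :=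
  (hasFDerivAt_spatialNormSq x).differentiableAt

/-! ### The radial multiplier and its derivatives -/

/-- **Derivatives of the radial multiplier `X⁰ = 0`, `X^α = g(s) y_α` (`α ≠ 0`)**: if `g` has
derivative `g'` at `s = |y⃗|²(x)`, then `∂_μ X^α (x) = 2 g' y_μ y_α [μ ≠ 0] + g(s) δ_μ^α` for
`α ≠ 0` and `0` for `α = 0`. [folklore] -/
theorem fderiv_radialMultiplier_apply {g : ℝ → ℝ} {g' : ℝ} {x : E4}
    (hg : HasDerivAt g g' (E4.spatialNorm x ^ 2)) (α μ : Fin 4) :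
    fderiv ℝ (fun y : E4 ↦ if α = 0 then (0 : ℝ) else g (E4.spatialNorm y ^ 2) * y α) x
        (E4.basisVector μ) =
      if α = 0 then 0 else
        g' * (if μ = 0 then 0 else 2 * x μ) * x α +
          g (E4.spatialNorm x ^ 2) * (if α = μ then 1 else 0) := by
  by_cases hα : α = 0
  · simp [hα]
  · simp only [hα, if_false]
    have hcomp : HasFDerivAt (fun y : E4 ↦ g (E4.spatialNorm y ^ 2))
        (g' • ((2 * x 1) • E4.dx 1 + (2 * x 2) • E4.dx 2 + (2 * x 3) • E4.dx 3)) x :=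
      hg.comp_hasFDerivAt x (hasFDerivAt_spatialNormSq x)
    have hprod := hcomp.mul (hasFDerivAt_coord α x)
    have hprod' : HasFDerivAt (fun y : E4 ↦ g (E4.spatialNorm y ^ 2) * y α) _ x := hprod
    rw [hprod'.fderiv]
    have hs := fderiv_spatialNormSq_apply x μ
    rw [(hasFDerivAt_spatialNormSq x).fderiv] at hs
    simp only [add_apply, smul_apply, smul_eq_mul, Kerr.dx_basisVector] at hs ⊢
    rw [hs]
    ring

/-- The radial multiplier is differentiable at `x` (componentwise) when `g` is differentiable at
`s(x)`. [folklore] -/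
theorem differentiableAt_radialMultiplier {g : ℝ → ℝ} {x : E4}
    (hg : DifferentiableAt ℝ g (E4.spatialNorm x ^ 2)) (α : Fin 4) :
    DifferentiableAt ℝ (fun y : E4 ↦ if α = 0 then (0 : ℝ) else g (E4.spatialNorm y ^ 2) * y α)
      x := by
  by_cases hα : α = 0
  · simp [hα]
  · simp only [hα, if_false]
    exact (hg.hasDerivAt.comp_hasFDerivAt x (hasFDerivAt_spatialNormSq x)).differentiableAt.mul
      (hasFDerivAt_coord α x).differentiableAt

/-! ### The bulk of a radial multiplier on Minkowski space -/

/-- Values of the Minkowski coefficients. [folklore] -/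
theorem etaComp_eq (μ ν : Fin 4) :
    Kerr.etaComp μ ν = if μ = ν then (if μ = 0 then -1 else 1) else 0 := rfl

/-- **The bulk term of a radial multiplier on Minkowski space.** For `X⁰ = 0`, `X^i = g(s) y_i`
with `g` differentiable at `s = |y⃗|²(x)` (derivative `g'`) and the constant coefficients
`η = diag(−1,1,1,1)`, with `p_μ = ∂_μ w(x)`, `y⃗·p⃗ = ∑_i y_i p_i`, `|p⃗|² = ∑_i p_i²`:
`K^X(x) = 2 g' (y⃗·p⃗)² + g(s) |p⃗|² − ½ (2 s g' + 3 g(s)) (−p₀² + |p⃗|²)`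
(`∂_i X^j = 2g' y_i y_j + g δ_{ij}`, `div X = 2sg' + 3g`, `∂η = 0`; in terms of `X = f(r)∂_r`,
`f = r g`: `K^X = f' p_r² + (f/r)(|p⃗|² − p_r²) − ½ (f' + 2f/r) Q`, Dafermos–Rodnianski
arXiv:0811.0354, §4.1). [cite: DafermosRodnianski2008, §4.1] -/
theorem multiplierBulk_eta_radial {g : ℝ → ℝ} {g' : ℝ} (w : E4 → ℝ) {x : E4}
    (hg : HasDerivAt g g' (E4.spatialNorm x ^ 2)) :
    multiplierBulk (fun _ ↦ Kerr.etaComp)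
        (fun y α ↦ if α = 0 then (0 : ℝ) else g (E4.spatialNorm y ^ 2) * y α) w x =
      2 * g' * (x 1 * fderiv ℝ w x (E4.basisVector 1) + x 2 * fderiv ℝ w x (E4.basisVector 2) +
            x 3 * fderiv ℝ w x (E4.basisVector 3)) ^ 2 +
        g (E4.spatialNorm x ^ 2) * (fderiv ℝ w x (E4.basisVector 1) ^ 2 +
            fderiv ℝ w x (E4.basisVector 2) ^ 2 + fderiv ℝ w x (E4.basisVector 3) ^ 2) -
        2⁻¹ * (2 * E4.spatialNorm x ^ 2 * g' + 3 * g (E4.spatialNorm x ^ 2)) *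
          (-fderiv ℝ w x (E4.basisVector 0) ^ 2 + (fderiv ℝ w x (E4.basisVector 1) ^ 2 +
            fderiv ℝ w x (E4.basisVector 2) ^ 2 + fderiv ℝ w x (E4.basisVector 3) ^ 2)) := by
  have hd := fderiv_radialMultiplier_apply hg
  have hη : ∀ α β : Fin 4, fderiv ℝ (fun _ : E4 ↦ Kerr.etaComp α β) x = 0 := fun α β ↦ by simp
  simp only [multiplierBulk, hd, hη, zero_apply, zero_mul, Finset.sum_const_zero,
    mul_zero, sub_zero]
  -- name the atoms and expand
  obtain ⟨p, hp⟩ : ∃ p : Fin 4 → ℝ, ∀ κ, fderiv ℝ w x (E4.basisVector κ) = p κ := ⟨_, fun _ ↦ rfl⟩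
  obtain ⟨G0, hG0⟩ : ∃ G0 : ℝ, g (E4.spatialNorm x ^ 2) = G0 := ⟨_, rfl⟩
  rw [E4.spatialNorm_sq] at hG0 ⊢
  simp only [hp, hG0, etaComp_eq, Fin.sum_univ_four, Fin.isValue]
  simp only [show (1 : Fin 4) ≠ 0 from by decide, show (2 : Fin 4) ≠ 0 from by decide,
    show (3 : Fin 4) ≠ 0 from by decide, show (0 : Fin 4) ≠ 1 from by decide,
    show (0 : Fin 4) ≠ 2 from by decide, show (0 : Fin 4) ≠ 3 from by decide,
    show (1 : Fin 4) ≠ 2 from by decide, show (1 : Fin 4) ≠ 3 from by decide,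
    show (2 : Fin 4) ≠ 1 from by decide, show (2 : Fin 4) ≠ 3 from by decide,
    show (3 : Fin 4) ≠ 1 from by decide, show (3 : Fin 4) ≠ 2 from by decide, if_true, if_false]
  ring

/-! ### The wave operator of a stationary radial weight -/

/-- **`□_η φ(s) = 4 s φ''(s) + 6 φ'(s)`** for the constant Minkowski coefficients and a weight
depending only on `s = |y⃗|²`, of class `C²` at `s(x)` (`□_η = −∂_t² + Δ` on `ℝ¹⁺³`,
`∂_i φ(s) = 2 y_i φ'`, `∂_i ∂_i φ(s) = 4 y_i² φ'' + 2 φ'`; Dafermos–Rodnianski arXiv:0811.0354,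
§4.1, the term `□w` of `K^{X,w}`). [cite: DafermosRodnianski2008, §4.1] -/
theorem waveOperator_eta_radial {φ : ℝ → ℝ} {x : E4}
    (hφ : ContDiffAt ℝ 2 φ (E4.spatialNorm x ^ 2)) :
    waveOperator (fun _ ↦ Kerr.etaComp) (fun y ↦ φ (E4.spatialNorm y ^ 2)) x =
      4 * E4.spatialNorm x ^ 2 * deriv (deriv φ) (E4.spatialNorm x ^ 2) +
        6 * deriv φ (E4.spatialNorm x ^ 2) := by
  -- abbreviations
  obtain ⟨S, hS⟩ : ∃ S : E4 → ℝ, ∀ y, S y = E4.spatialNorm y ^ 2 := ⟨_, fun _ ↦ rfl⟩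
  have hSfun : (fun y : E4 ↦ E4.spatialNorm y ^ 2) = S := funext fun y ↦ (hS y).symm
  have hSd : ∀ y, HasFDerivAt S ((2 * y 1) • E4.dx 1 + (2 * y 2) • E4.dx 2 + (2 * y 3) • E4.dx 3) y :=
    fun y ↦ by rw [← hSfun]; exact hasFDerivAt_spatialNormSq y
  have hSc : Continuous S := continuous_iff_continuousAt.mpr fun y ↦ (hSd y).continuousAt
  have hφS : (fun z : E4 ↦ φ (E4.spatialNorm z ^ 2)) = fun z ↦ φ (S z) :=
    funext fun z ↦ by rw [hS]
  -- `φ` is differentiable near `S x`, and `deriv φ` is differentiable at `S x`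
  have hφ1 : ∀ᶠ t in 𝓝 (S x), DifferentiableAt ℝ φ t := by
    have h := hφ.eventually (by simp)
    rw [← hS] at h
    filter_upwards [h] with t ht using ht.differentiableAt (by simp)
  have hφ2 : DifferentiableAt ℝ (deriv φ) (S x) := by
    have h1 : DifferentiableAt ℝ (fderiv ℝ φ) (E4.spatialNorm x ^ 2) :=
      (hφ.fderiv_right (m := 1) le_rfl).differentiableAt (by simp)
    have h2 : deriv φ = fun t ↦ fderiv ℝ φ t 1 := funext fun t ↦ rfl
    rw [h2, hS]
    exact h1.clm_apply (differentiableAt_const _)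
  -- the inner vector field `A^μ = ∑_ν η^{μν} ∂_ν (φ ∘ S)` near `x`
  have hinner : ∀ μ : Fin 4, (fun y : E4 ↦ ∑ ν, Kerr.etaComp μ ν *
      fderiv ℝ (fun z ↦ φ (E4.spatialNorm z ^ 2)) y (E4.basisVector ν)) =ᶠ[𝓝 x]
      fun y ↦ if μ = 0 then 0 else 2 * deriv φ (S y) * y μ := by
    intro μ
    have hnear : ∀ᶠ y in 𝓝 x, DifferentiableAt ℝ φ (S y) := hSc.continuousAt.eventually hφ1
    filter_upwards [hnear] with y hy
    have hcomp : HasFDerivAt (fun z : E4 ↦ φ (E4.spatialNorm z ^ 2))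
        (deriv φ (S y) • ((2 * y 1) • E4.dx 1 + (2 * y 2) • E4.dx 2 + (2 * y 3) • E4.dx 3)) y := by
      rw [hφS]
      exact hy.hasDerivAt.comp_hasFDerivAt y (hSd y)
    simp only [hcomp.fderiv, smul_apply, add_apply, smul_eq_mul, Kerr.dx_basisVector, etaComp_eq,
      Fin.sum_univ_four, Fin.isValue]
    fin_cases μ <;> simp <;> ring
  -- differentiate `A^μ` at `x`
  have hderiv : ∀ μ : Fin 4, fderiv ℝ (fun y : E4 ↦ ∑ ν, Kerr.etaComp μ ν *
      fderiv ℝ (fun z ↦ φ (E4.spatialNorm z ^ 2)) y (E4.basisVector ν)) x (E4.basisVector μ) =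
      if μ = 0 then 0 else
        2 * (deriv (deriv φ) (S x) * (2 * x μ) * x μ + deriv φ (S x)) := by
    intro μ
    rw [(hinner μ).fderiv_eq]
    by_cases hμ : μ = 0
    · simp [hμ]
    · simp only [hμ, if_false]
      have h1 : HasFDerivAt (fun y : E4 ↦ deriv φ (S y))
          (deriv (deriv φ) (S x) • ((2 * x 1) • E4.dx 1 + (2 * x 2) • E4.dx 2 +
            (2 * x 3) • E4.dx 3)) x :=
        hφ2.hasDerivAt.comp_hasFDerivAt x (hSd x)
      have h2 := ((h1.const_mul 2).mul (hasFDerivAt_coord μ x))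
      have h2' : HasFDerivAt (fun y : E4 ↦ 2 * deriv φ (S y) * y μ) _ x := h2
      rw [h2'.fderiv]
      simp only [add_apply, smul_apply, smul_eq_mul, Kerr.dx_basisVector]
      fin_cases μ
      · exact absurd rfl hμ
      all_goals simp; ring
  show ∑ μ, fderiv ℝ (fun y : E4 ↦ ∑ ν, Kerr.etaComp μ ν *
      fderiv ℝ (fun z ↦ φ (E4.spatialNorm z ^ 2)) y (E4.basisVector ν)) x (E4.basisVector μ) = _
  rw [Fin.sum_univ_four, hderiv 0, hderiv 1, hderiv 2, hderiv 3]
  simp only [Fin.isValue, if_true, show (1 : Fin 4) ≠ 0 from by decide,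
    show (2 : Fin 4) ≠ 0 from by decide, show (3 : Fin 4) ≠ 0 from by decide, if_false]
  rw [hS, E4.spatialNorm_sq]
  ring

/-! ### Morawetz's multiplier `X = ∂_r` -/

/-- `d/du [4/√u] = −2/(u√u)` for `u > 0`. [folklore] -/
theorem hasDerivAt_four_div_sqrt {t : ℝ} (ht : 0 < t) :
    HasDerivAt (fun u ↦ 4 * (Real.sqrt u)⁻¹) (-2 * (t * Real.sqrt t)⁻¹) t := by
  have hs : Real.sqrt t ≠ 0 := (Real.sqrt_pos.mpr ht).ne'
  have h1 : HasDerivAt (fun u ↦ 4 * (Real.sqrt u)⁻¹)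
      (4 * (-(1 / (2 * Real.sqrt t)) / Real.sqrt t ^ 2)) t :=
    ((Real.hasDerivAt_sqrt ht.ne').inv hs).const_mul 4
  refine h1.congr_deriv ?_
  rw [Real.sq_sqrt ht.le]
  field_simp
  ring

/-- `d/du [−2/(u√u)] = 3/(u²√u)` for `u > 0`. [folklore] -/
theorem hasDerivAt_neg_two_div_mul_sqrt {t : ℝ} (ht : 0 < t) :
    HasDerivAt (fun u ↦ -2 * (u * Real.sqrt u)⁻¹) (3 * (t ^ 2 * Real.sqrt t)⁻¹) t := by
  have hs : Real.sqrt t ≠ 0 := (Real.sqrt_pos.mpr ht).ne'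
  have hprod : HasDerivAt (fun u ↦ u * Real.sqrt u)
      (1 * Real.sqrt t + t * (1 / (2 * Real.sqrt t))) t :=
    (hasDerivAt_id t).mul (Real.hasDerivAt_sqrt ht.ne')
  have h : HasDerivAt (fun u ↦ -2 * (u * Real.sqrt u)⁻¹)
      (-2 * (-(1 * Real.sqrt t + t * (1 / (2 * Real.sqrt t))) / (t * Real.sqrt t) ^ 2)) t :=
    (hprod.inv (mul_ne_zero ht.ne' hs)).const_mul (-2)
  refine h.congr_deriv ?_
  have hst : Real.sqrt t ^ 2 = t := Real.sq_sqrt ht.le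
  rw [mul_pow, hst]
  field_simp
  rw [hst]
  ring

/-- **`□_η (4/r) = 0` away from the axis**: the Lagrangian weight `ϖ = 4/r` of Morawetz's
`∂_r`-multiplier is `η`-harmonic on `{r > 0}` (`Δ(1/r) = 0` on `ℝ³ ∖ {0}`), so the modified
current `J^{∂_r} + ¼ L_{4/r}` costs no zeroth-order bulk term there (Dafermos–Rodnianski
arXiv:0811.0354, §4.1). [cite: DafermosRodnianski2008, §4.1] -/
theorem waveOperator_eta_four_div_r {x : E4} (hx : 0 < E4.spatialNorm x) :
    waveOperator (fun _ ↦ Kerr.etaComp) (fun y ↦ 4 / E4.spatialNorm y) x = 0 := by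
  have hr2 : 0 < E4.spatialNorm x ^ 2 := by positivity
  have hfun : (fun y : E4 ↦ 4 / E4.spatialNorm y) =
      fun y ↦ (fun u ↦ 4 * (Real.sqrt u)⁻¹) (E4.spatialNorm y ^ 2) := by
    funext y
    simp only [Real.sqrt_sq (E4.spatialNorm_nonneg y), div_eq_mul_inv]
  have hφ : ContDiffAt ℝ 2 (fun u ↦ 4 * (Real.sqrt u)⁻¹) (E4.spatialNorm x ^ 2) :=
    contDiffAt_const.mul ((Real.contDiffAt_sqrt hr2.ne').inv (Real.sqrt_ne_zero'.mpr hr2))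
  rw [hfun, waveOperator_eta_radial hφ]
  have hd1 : deriv (fun u ↦ 4 * (Real.sqrt u)⁻¹) =ᶠ[𝓝 (E4.spatialNorm x ^ 2)]
      fun u ↦ -2 * (u * Real.sqrt u)⁻¹ := by
    filter_upwards [Ioi_mem_nhds hr2] with u hu using (hasDerivAt_four_div_sqrt hu).deriv
  have hφ' : deriv (fun u ↦ 4 * (Real.sqrt u)⁻¹) (E4.spatialNorm x ^ 2) =
      -2 * (E4.spatialNorm x ^ 2 * E4.spatialNorm x)⁻¹ := by
    rw [(hasDerivAt_four_div_sqrt hr2).deriv, Real.sqrt_sq hx.le]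
  have hφ'' : deriv (deriv (fun u ↦ 4 * (Real.sqrt u)⁻¹)) (E4.spatialNorm x ^ 2) =
      3 * ((E4.spatialNorm x ^ 2) ^ 2 * E4.spatialNorm x)⁻¹ := by
    rw [hd1.deriv_eq, (hasDerivAt_neg_two_div_mul_sqrt hr2).deriv, Real.sqrt_sq hx.le]
  rw [hφ', hφ'']
  have hr : E4.spatialNorm x ≠ 0 := hx.ne'
  have h5 : (E4.spatialNorm x ^ 2) ^ 2 * E4.spatialNorm x =
      E4.spatialNorm x ^ 2 * (E4.spatialNorm x ^ 2 * E4.spatialNorm x) := by ring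
  rw [h5, mul_inv]
  field_simp
  ring

/-- **Morawetz's identity for the multiplier `X = ∂_r` on Minkowski space** (`X⁰ = 0`,
`X^i = y_i / r`, `r = |y⃗| > 0`): with `p_μ = ∂_μw(x)`, `y⃗·p⃗ = ∑ y_i p_i`, `|p⃗|² = ∑ p_i²`,
`Q = −p₀² + |p⃗|²` and the Lagrangian weight `ϖ = 4/r`,
`K^{∂_r} + ¼ ϖ Q = (|p⃗|² r² − (y⃗·p⃗)²)/r³ = |∇̸w|²/r`
— the angular derivatives only (Morawetz 1968; Dafermos–Rodnianski arXiv:0811.0354, §4.1: the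
bulk `K^{X,w}` of `J^{X,w}` with `X = ∂_r`). [cite: DafermosRodnianski2008, §4.1] -/
theorem multiplierBulk_eta_dr_add (w : E4 → ℝ) {x : E4} (hx : 0 < E4.spatialNorm x) :
    multiplierBulk (fun _ ↦ Kerr.etaComp)
          (fun y α ↦ if α = 0 then (0 : ℝ) else y α / E4.spatialNorm y) w x +
        4⁻¹ * (4 / E4.spatialNorm x) *
          (-fderiv ℝ w x (E4.basisVector 0) ^ 2 + (fderiv ℝ w x (E4.basisVector 1) ^ 2 +
            fderiv ℝ w x (E4.basisVector 2) ^ 2 + fderiv ℝ w x (E4.basisVector 3) ^ 2)) =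
      ((fderiv ℝ w x (E4.basisVector 1) ^ 2 + fderiv ℝ w x (E4.basisVector 2) ^ 2 +
            fderiv ℝ w x (E4.basisVector 3) ^ 2) * E4.spatialNorm x ^ 2 -
          (x 1 * fderiv ℝ w x (E4.basisVector 1) + x 2 * fderiv ℝ w x (E4.basisVector 2) +
            x 3 * fderiv ℝ w x (E4.basisVector 3)) ^ 2) /
        E4.spatialNorm x ^ 3 := by
  have hs0 : Real.sqrt (E4.spatialNorm x ^ 2) = E4.spatialNorm x := Real.sqrt_sq hx.le
  have hr2 : E4.spatialNorm x ^ 2 ≠ 0 := by positivity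
  have hsq : Real.sqrt (E4.spatialNorm x ^ 2) ≠ 0 := by rw [hs0]; exact hx.ne'
  have hg : HasDerivAt (fun u ↦ (Real.sqrt u)⁻¹)
      (-(1 / (2 * Real.sqrt (E4.spatialNorm x ^ 2))) / Real.sqrt (E4.spatialNorm x ^ 2) ^ 2)
      (E4.spatialNorm x ^ 2) := (Real.hasDerivAt_sqrt hr2).inv hsq
  have hfun : (fun (y : E4) (α : Fin 4) ↦ if α = 0 then (0 : ℝ) else y α / E4.spatialNorm y) =
      fun y α ↦ if α = 0 then 0 else (fun u ↦ (Real.sqrt u)⁻¹) (E4.spatialNorm y ^ 2) * y α := by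
    funext y α
    simp only [Real.sqrt_sq (E4.spatialNorm_nonneg y), div_eq_inv_mul]
  rw [hfun, multiplierBulk_eta_radial w hg, hs0]
  have hr : E4.spatialNorm x ≠ 0 := hx.ne'
  field_simp
  ring

/-- **Morawetz's bulk is non-negative**: `K^{∂_r} + ¼ (4/r) Q = |∇̸w|²/r ≥ 0` on `{r > 0}`
(Cauchy–Schwarz `(y⃗·p⃗)² ≤ r² |p⃗|²`). [cite: DafermosRodnianski2008, §4.1] -/
theorem multiplierBulk_eta_dr_add_nonneg (w : E4 → ℝ) {x : E4} (hx : 0 < E4.spatialNorm x) :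
    0 ≤ multiplierBulk (fun _ ↦ Kerr.etaComp)
          (fun y α ↦ if α = 0 then (0 : ℝ) else y α / E4.spatialNorm y) w x +
        4⁻¹ * (4 / E4.spatialNorm x) *
          (-fderiv ℝ w x (E4.basisVector 0) ^ 2 + (fderiv ℝ w x (E4.basisVector 1) ^ 2 +
            fderiv ℝ w x (E4.basisVector 2) ^ 2 + fderiv ℝ w x (E4.basisVector 3) ^ 2)) := by
  rw [multiplierBulk_eta_dr_add w hx]
  refine div_nonneg ?_ (pow_nonneg hx.le 3)
  rw [E4.spatialNorm_sq]
  -- name the atoms; Cauchy–Schwarz in `ℝ³`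
  obtain ⟨p1, hp1⟩ : ∃ p1, fderiv ℝ w x (E4.basisVector 1) = p1 := ⟨_, rfl⟩
  obtain ⟨p2, hp2⟩ : ∃ p2, fderiv ℝ w x (E4.basisVector 2) = p2 := ⟨_, rfl⟩
  obtain ⟨p3, hp3⟩ : ∃ p3, fderiv ℝ w x (E4.basisVector 3) = p3 := ⟨_, rfl⟩
  rw [hp1, hp2, hp3]
  nlinarith [sq_nonneg (x 1 * p2 - x 2 * p1), sq_nonneg (x 1 * p3 - x 3 * p1),
    sq_nonneg (x 2 * p3 - x 3 * p2)]

end KerrSchild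

end Literature.Geometry.Lorentzian
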